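import Literature.MathematicalPhysics.QuantumFieldTheory.Balaban1983to89.B9Eq3104CommutatorSizesCurl
import Literature.MathematicalPhysics.QuantumFieldTheory.Balaban1983to89.B9Eq3104CommutatorSizesCurv
import Literature.MathematicalPhysics.QuantumFieldTheory.Balaban1983to89.B9Eq3104CommutatorSizesAvg

/-!
# `Balaban1983to89.B9Eq3104CommutatorSizes` — T. Bałaban, *Propagators for lattice gauge theories in a background field*,
# Commun. Math. Phys. **99** (1985) 389–434 [Balaban1985BackgroundPropagators], p. 409 («K(h_□) … satisfies the inequality (3.89)») with Sect. C p. 414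
# l. 1–3 and (3.102): **THE PRINT-SHAPE SIZE OF THE WHOLE CUT-OFF COMMUTATOR `K(h_□)(U) = [h_□, Δ_loc(U)]` OF THE BOND SECTOR AT THE COVER OF RECORD** —
# the four pieces `[h_□, D*_U𝒦_UD_U] + [h_□, Δ′₂(U)] + [h_□, ∇_U∇*_U] + [h_□, Q*_UaQ_U]` of this seat's files D′₂ ∕ D′₃b ∕ D′₁ ∕ D′₃a assembled into ONE bound
# against local sup data of `A` and the displayed class constants (module M5.7-est, file E′₁; the (3.89)-twin in (3.42)-currency is E′₂)

statement-level skeleton of published theorems with citation tags; proofs where landed; nothing here is a claim about the Yang–Mills mass gap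

## WHAT THIS FILE PROVES (THEOREMS only; 0 definitions, 0 `def … : Prop`, 0 sorry)
* `KhBY_eq_four` — `K(h)(U) = [h, D*𝒦D] + [h, Δ′₂] + [h, DD*] + [h, Q*aQ]` (this seat's `deltaLocY`, def-Y's `hessY`, `cutCommR_add`).
* ★★★ `norm_KhBY_hTY_apply_le` — **`K(h_□)(U)A` AT A BOND, SIZED**: for bi-contractive `U` and contour transporters, the DISPLAYED class constants
  (`δ_P` plaquette holonomy, `ρ ≥ ‖Re U(∂p)‖`, `δ_K` conjugation defect of the Jordan insertion, `δ_I ≥ ‖c_f²Im U(∂p)‖` — all trivial at `U = 1`: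
  `0, ‖1‖, 0, 0`), and local data of `A` near `b` (`G₀`: components within two steps and on the plaquettes through `b`; `G₁`: their `∇`∕`∇*` entries;
  `P`: the level-free product `w_y‖A(f)‖` on the double blocks met):
  `‖(K(h_□)(U)A)(b)‖ ≤ |c_f|(d+1)·4·(|c_f|ρ(2θ₁G₁ + (θ₁δ_P + θ₂)G₀) + θ₁δ_KG₀) + 64(d+1)δ_Iθ₁G₀ + c_f²(d+1)(2θ₁G₁ + (θ₁δ_P + θ₂)G₀) + 2θ_QP·Σ_y|Q*(b,y)|`,
  `θ₁ = C1F∕(8S_j∕5)`, `θ₂ = C2X∕(8S_j∕5)²`, `θ_Q = sLipT∕(L·M_h)·(L+3)` — print's «O(M⁻¹), or O(M⁻²), if considered on a proper scale» once `G₁ ~ B₀L^j∕c_f²`,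
  `G₀ ~ B₀L^{2j}∕c_f²`, `P ~ B₀` are fed from the Thm-3.3-type entries (file E′₂).
HONEST SCOPE.  No (3.42)-currency, no level bookkeeping, no exponential factor here (file E′₂); nothing of Thm 3.10 ∕ 3.3 asserted; YM mass gap NOT proved
by any of this (Track A conditional rung).  `--supports stmt-QuantumFields-19200`.  Net new unproved facts: 0.
-/

noncomputable section

namespace Literature.MathematicalPhysics.QuantumFieldTheory.Balaban1983to89.B9Eq3104CommutatorSizes

open Node00
open B9Thm37CubeCoverCommutators (cutMulY hTY)
open B9Eq3104CutoffCommutators (cutCommR cutCommR_add hBdY KhBY deltaLocY)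
open B9Eq3104CommutatorSizesDD (norm_cutCommR_gradY_divY_hTY_apply_le_grad)
open B9Eq3104CommutatorSizesCurl (norm_cutCommR_sandwich_hTY_apply_le jIns norm_jIns_le hessCurlY_apply_eq)
open B9Eq3104CommutatorSizesCurv (norm_cutCommR_curv2Y_hTY_apply_le)
open B9Eq3104CommutatorSizesAvg (norm_cutCommR_QsY_aY_QY_hTY_apply_le)
open B6KLevelCensusIndexV1 (KIdx)
open B6MultiLevelBoxOperator (bigSide)
open B6Cover236MultiLevelBlocks (cubes)
open B6Partition118KLevelFineSizes (C1F)
open B6Partition118KLevelFineMixed (C2X)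
open B6Partition118KLevelTorusBinders (sLipT)
open Node00.OpsYNablaBridge (chartY bondCompY)
open B9Eq39Adjoint (R plaqU)
open scoped Matrix

variable {𝔸 : Type} [NormedRing 𝔸] [NormedAlgebra ℂ 𝔸] [CompleteSpace 𝔸]
variable {d ℓ : ℕ} {hd : 1 ≤ d + 1} {hL : Odd (ℓ + 1) ∧ 1 < ℓ + 1} {b₀ b₁ : ℝ}
variable (i : KIdx d ℓ hd hL b₀ b₁)

/-- `K(h)(U) = [h, D*𝒦D] + [h, Δ′₂] + [h, DD*] + [h, Q*aQ]`. [cite: Balaban1985BackgroundPropagators, (3.10) p.392, (3.25) p.395, p.409, p.414 l.1–3] -/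
theorem KhBY_eq_four (h : SiteY i → ℝ) (parB : BondParY 𝔸 i) (U : CfgY 𝔸 i) :
    KhBY i h parB U
      = cutCommR (hBdY i h) (hBdY i h) (coCurlY i U ∘ₗ jordanY i U ∘ₗ curlY i U)
        + cutCommR (hBdY i h) (hBdY i h) (curv2Y i U)
        + cutCommR (hBdY i h) (hBdY i h) (gradY i U ∘ₗ divY i U)
        + cutCommR (hBdY i h) (hBdY i h) (QsY i parB U ∘ₗ aY i ∘ₗ QY i parB U) := by
  rw [KhBY, deltaLocY, hessY, cutCommR_add, cutCommR_add, cutCommR_add]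

/-- ★★★ **`K(h_□)(U)A` AT A BOND, SIZED IN PRINT'S SHAPE — p. 409 ∕ p. 414** (see the module docstring for the legend of the constants and the local data).
[cite: Balaban1985BackgroundPropagators, (3.89) p.409 («K(h_□) … satisfies the inequality (3.89)»), p.414 l.1–3, (3.102) p.414, (3.10) p.392; Balaban1984PropagatorsII, p.247] -/
theorem norm_KhBY_hTY_apply_le (c : ↥(cubes i.D.toDomains)) (parB : BondParY 𝔸 i) (U : CfgY 𝔸 i)
    (hU : ∀ μ x, ‖(U μ x : 𝔸)‖ ≤ 1 ∧ ‖(((U μ x)⁻¹ : 𝔸ˣ) : 𝔸)‖ ≤ 1)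
    (hT : ∀ (y : IBondY i) (f : FBondY i), ‖(qT i parB U y f : 𝔸)‖ ≤ 1 ∧ ‖(((qT i parB U y f)⁻¹ : 𝔸ˣ) : 𝔸)‖ ≤ 1)
    {δP ρ δK δI : ℝ} (hδP : 0 ≤ δP) (hρ : 0 ≤ ρ) (hδK : 0 ≤ δK) (hδI : 0 ≤ δI)
    (hP : ∀ (μ lam : Fin (d + 1)) (w : SiteY i) (Y : 𝔸), ‖R (plaqU (shiftY i) (UboxY i U) μ lam w) Y - Y‖ ≤ δP * ‖Y‖)
    (hRe : ∀ p : PlaqY i, ‖reHolY i U p‖ ≤ ρ)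
    (hKc : ∀ a e (μ : Fin (d + 1)) (x : SiteY i) (Z : 𝔸),
      ‖R (UboxY i U μ ((shiftY i μ).symm x))⁻¹ (jIns i U a e ((shiftY i μ).symm x) (R (UboxY i U μ ((shiftY i μ).symm x)) Z)) - jIns i U a e x Z‖
        ≤ δK * ‖Z‖)
    (hI : ∀ p : PlaqY i, ‖((i.cf ^ 2 : ℝ) : ℂ) • imHolY i U p‖ ≤ δI)
    (A : FBondY i → 𝔸) (b : FBondY i) {G₀ G₁ P : ℝ} (hG₀ : 0 ≤ G₀)
    (hA₀ : ∀ a lam μ : Fin (d + 1), ‖bondCompY i a A ((shiftY i μ).symm (chartY i b.src))‖ ≤ G₀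
      ∧ ‖bondCompY i a A (shiftY i lam ((shiftY i μ).symm (chartY i b.src)))‖ ≤ G₀)
    (hA₀' : ∀ (p : PlaqY i) (m l : Fin 4), edgeY i p m = b → ‖A (edgeY i p l)‖ ≤ G₀)
    (hA₁ : ∀ a lam μ : Fin (d + 1), ‖cdS i U lam (bondCompY i a A) ((shiftY i μ).symm (chartY i b.src))‖ ≤ G₁
      ∧ ‖cdsS i U μ (bondCompY i a A) (shiftY i lam (chartY i b.src))‖ ≤ G₁)
    (hAP : ∀ (y : IBondY i) (f : FBondY i), qsK i b y ≠ 0 → qK i y f ≠ 0 → i.w y * ‖A f‖ ≤ P) :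
    ‖KhBY i (hTY i c) parB U A b‖
      ≤ |i.cf| * (((d : ℝ) + 1) * (4 * (|i.cf| * ρ * (2 * (C1F d ℓ / (8 / 5 * (bigSide ℓ i.Mh c.1.1 : ℝ))) * G₁
            + (C1F d ℓ / (8 / 5 * (bigSide ℓ i.Mh c.1.1 : ℝ)) * δP + C2X d ℓ / (8 / 5 * (bigSide ℓ i.Mh c.1.1 : ℝ)) ^ 2) * G₀)
            + C1F d ℓ / (8 / 5 * (bigSide ℓ i.Mh c.1.1 : ℝ)) * δK * G₀)))
        + 64 * ((d : ℝ) + 1) * δI * (C1F d ℓ / (8 / 5 * (bigSide ℓ i.Mh c.1.1 : ℝ))) * G₀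
        + i.cf ^ 2 * (((d : ℝ) + 1) * (2 * (C1F d ℓ / (8 / 5 * (bigSide ℓ i.Mh c.1.1 : ℝ))) * G₁
            + (C1F d ℓ / (8 / 5 * (bigSide ℓ i.Mh c.1.1 : ℝ)) * δP + C2X d ℓ / (8 / 5 * (bigSide ℓ i.Mh c.1.1 : ℝ)) ^ 2) * G₀))
        + 2 * (sLipT d ℓ / (((ℓ : ℝ) + 1) * i.Mh) * (((ℓ : ℝ) + 1) + 3)) * P * ∑ y, |qsK i b y| := by
  rw [KhBY_eq_four, LinearMap.add_apply, LinearMap.add_apply, LinearMap.add_apply, Pi.add_apply, Pi.add_apply, Pi.add_apply]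
  -- (1) the Hessian-curl piece (D′₂) with the Jordan insertion `jIns`
  have h1 := norm_cutCommR_sandwich_hTY_apply_le i c U hU hδP hP (jIns i U) (κ := |i.cf| * ρ) (by positivity) hδK
    (norm_jIns_le i U hρ hRe) hKc (coCurlY i U ∘ₗ jordanY i U ∘ₗ curlY i U) (hessCurlY_apply_eq i U) A b
    (G₀ := G₀) (G₁ := G₁) (fun a lam μ => (hA₀ a lam μ).2) hA₁
  -- (2) the curvature piece (D′₃b)
  have h2 := norm_cutCommR_curv2Y_hTY_apply_le i c U hU hδI hI A b hG₀ hA₀'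
  -- (3) the `DD*` piece (D′₁)
  have h3 := norm_cutCommR_gradY_divY_hTY_apply_le_grad i c U hU hδP hP A b (G₀ := G₀) (G₁ := G₁)
    (fun μ => ⟨(hA₀ μ b.dir μ).1, (hA₀ μ b.dir μ).2⟩) (fun μ => ⟨(hA₁ μ b.dir μ).1, (hA₁ μ b.dir μ).2⟩)
  -- (4) the averaging piece (D′₃a)
  have h4 := norm_cutCommR_QsY_aY_QY_hTY_apply_le i c parB U hT A b (P := P) hAP
  exact (norm_add_le _ _).trans (add_le_add ((norm_add_le _ _).trans (add_le_add ((norm_add_le _ _).trans (add_le_add h1 h2)) h3)) h4)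

end Literature.MathematicalPhysics.QuantumFieldTheory.Balaban1983to89.B9Eq3104CommutatorSizes

end
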